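import Summits.CriticalPhenomena.SAWScalingLimit.Theses.SAWDefectDecoherence
import Summits.CriticalPhenomena.SAWScalingLimit.Theorems.BoundaryClosureNegative_Instance
import Summits.CriticalPhenomena.SAWScalingLimit.Theorems.HexSAWScalingLimit

/-!
# Crux `ObservableToSLER` (stmt-CriticalPhenomena-14005): the root pin of `HexObservableLimitR` is load-bearing

Negative lemma (refuter, cdisprove cycle 1) for the glue crux
`ObservableToSLER : HexObservableLimitR → HexTight → ⟨DCS 2012 Conjecture 1⟩`.

`HexObservableLimitRootFree` is the crux's hypothesis `HexObservableLimitR` (item 14003) with its two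
ROOT clauses deleted (the flat ball at `pt 0` and the exact half-lattice at `pt 0`) — verbatim the
refuted item stmt-CriticalPhenomena-5420.  We prove:

* `obsLimitR_of_rootFree` — the root-free form is a strengthening of `HexObservableLimitR`;
* `not_rootFree` — it is FALSE: the corridor witness of
  `SAWDefectDecoherenceHexObservableLimit_refuted`, replayed on the landed engine
  `Theorems/BoundaryClosureNegative_*` (`instance_limit`, `ratio_eq`, `endgame`), so that this
  module does not depend on the retired declaration;
* `observableToSLER_withRootFreeHyp` — hence the crux with its hypothesis strengthened back to the
  root-free form is vacuously true (that strengthening is worthless).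

Reading for provers: the intended proof of the crux must bootstrap Conjecture 2 from the
flat-pinned family of `HexObservableLimitR` to the SAW's own slit domains `Ω ∖ γ[0,n]`, whose root
(the tip) is rough.  That bootstrap can NOT land in the root-free ψ-averaged form: any admissible
rough-root statement must keep lattice control at the root (the witness relocates the conformal
root inside a free `o(1)`-collar; slit domains carry the canonical lattice at the tip).

Since rev 17 of the route file (2026-08-16) the shared conjecture item `HexConjecture` (stmt-0808) is
no longer declared by route `SAWDefectDecoherence`; `SAWDefectDecoherence.HexConjecture` is re-declared
below as an alias of the registered conjecture node `HexSAWScalingLimit` so that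
`observableToSLER_withRootFreeHyp` keeps its statement.
-/

noncomputable section

open Literature.Probability.RandomPlanarGeometry Literature.Probability.RandomPlanarGeometry.SAW
  Literature.Probability.LatticeModels MeasureTheory Filter Topology Set

namespace Summit.CriticalPhenomena.SAWScalingLimit.Theses.SAWDefectDecoherence

/-- `SAWDefectDecoherence.HexConjecture`: the shared OPEN item `HexConjecture`
(stmt-CriticalPhenomena-0808 — Duminil-Copin–Smirnov 2012, Conjecture 1: the critical hexagonal SAW
converges in law to chordal SLE(8/3)), which route `SAWDefectDecoherence` listed until rev 17
(2026-08-16T03:09:13Z, dropped by route-choice; the item stays with the sibling routes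
`SAWHexUniversality` / `SAWBrickWallHomotopy` / `SAWDevelopingMap`, and its statement is written out
verbatim as the conclusion of this route's crux `ObservableToSLER`).  Re-declared here BY NAME, as
the tree's registered conjecture node `Summit.CriticalPhenomena.SAWScalingLimit.HexSAWScalingLimit`
(`Theorems/HexSAWScalingLimit.lean`, `@[conjecture]`; definitionally the item's statement), solely so
that the vacuous negative lemma `observableToSLER_withRootFreeHyp` below keeps elaborating unchanged
after the route file stopped declaring it (an alias of an open registered statement: not a fact, no
claim attached). -/
abbrev HexConjecture : Prop :=
  Summit.CriticalPhenomena.SAWScalingLimit.HexSAWScalingLimit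

end Summit.CriticalPhenomena.SAWScalingLimit.Theses.SAWDefectDecoherence

namespace Summit.CriticalPhenomena.SAWScalingLimit.Theorems.ObservableToSLER.Negative

open Summit.CriticalPhenomena.SAWScalingLimit.Theses
open Summit.CriticalPhenomena.SAWScalingLimit.Theorems.BoundaryClosure.Negative

/-- `HexObservableLimitR` (item stmt-CriticalPhenomena-14003) with the two ROOT clauses deleted — the
flat ball and the exact half-lattice are required at `pt 1` only (`m : ℝ → ℤ`); verbatim the refuted
item stmt-CriticalPhenomena-5420 (a FALSE auxiliary statement, see `not_rootFree`; not a fact). -/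
def HexObservableLimitRootFree : Prop :=
  ∃ c : ℂ, c ≠ 0 ∧ ∀ (D : DobrushinDomain) (ρ : ℝ) (Λ : ℝ → Finset HexVertex) (m : ℝ → ℤ)
    (a b : ℝ → Sym2 HexVertex) (Φ : ConformalEquiv D.carrier UpperHalfPlane.upperHalfPlaneSet)
    (L : ℂ → ℂ) (Lb : ℂ) (ψ : ℂ → ℂ),
    let F : ℝ → Sym2 HexVertex → ℂ := fun δ z =>
      hexParafermionicObservable (Λ δ) (a δ) hexCriticalFugacity (5 / 8) z
    0 < ρ →
    D.carrier ∩ Metric.ball (D.pt 1) ρ = {z : ℂ | (D.pt 1).im < z.im} ∩ Metric.ball (D.pt 1) ρ →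
    (∀ᶠ δ : ℝ in nhdsWithin 0 (Set.Ioi 0),
      hexDomainSimplyConnected (Λ δ) ∧ a δ ∈ hexDomainBoundary (Λ δ) ∧
        b δ ∈ hexDomainBoundary (Λ δ) ∧ Nonempty (HexMidEdgeSAW (Λ δ) (a δ) (b δ)) ∧
        (hexGraph.induce ((Λ δ : Finset HexVertex) : Set HexVertex)).Preconnected ∧
        (∀ v ∈ Λ δ, (δ : ℂ) * hexCenter v ∈ D.carrier) ∧
        (∀ v : HexVertex, (δ : ℂ) * hexCenter v ∈ Metric.ball (D.pt 1) ρ →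
          (v ∈ Λ δ ↔ m δ ≤ v.1 1))) →
    (∀ K : Set ℂ, IsCompact K → K ⊆ D.carrier → ∀ᶠ δ : ℝ in nhdsWithin 0 (Set.Ioi 0),
      ∀ v : HexVertex, (δ : ℂ) * hexCenter v ∈ K → v ∈ Λ δ) →
    Tendsto (fun δ : ℝ => (δ : ℂ) * hexMidpoint (a δ)) (nhdsWithin 0 (Set.Ioi 0)) (nhds (D.pt 0)) →
    Tendsto (fun δ : ℝ => (δ : ℂ) * hexMidpoint (b δ)) (nhdsWithin 0 (Set.Ioi 0)) (nhds (D.pt 1)) →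
    Tendsto (fun x => ‖Φ x‖) (nhdsWithin (D.pt 0) D.carrier) atTop →
    Φ.HasBoundaryValue (D.pt 1) 0 →
    ContinuousOn L D.carrier → (∀ z ∈ D.carrier, Complex.exp (L z) = deriv Φ z) →
    Tendsto L (nhdsWithin (D.pt 1) D.carrier) (nhds Lb) →
    Continuous ψ → HasCompactSupport ψ → tsupport ψ ⊆ D.carrier →
    Tendsto (fun δ : ℝ => (δ : ℂ) ^ 2 * (∑ᶠ e ∈ hexDomainMidEdges (Λ δ),
      ψ ((δ : ℂ) * hexMidpoint e) * F δ e) / F δ (b δ)) (nhdsWithin 0 (Set.Ioi 0))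
      (nhds (c * ∫ z, ψ z * Complex.exp ((5 / 8 : ℂ) * (L z - Lb))))

/-- The root-free form is a STRENGTHENING of `HexObservableLimitR`: it assumes less per domain, so it
implies the crux's hypothesis. [folklore] -/
theorem obsLimitR_of_rootFree (h : HexObservableLimitRootFree) :
    SAWDefectDecoherence.HexObservableLimitR := by
  obtain ⟨c, hc, H⟩ := h
  refine ⟨c, hc, ?_⟩
  intro D ρ Λ m a b Φ L Lb ψ F hρ hflat hdisc hK ha hb hΦ hΦb hL hexp hLb hψ hψK hψD
  exact H D ρ Λ (m 1) a b Φ L Lb ψ hρ (hflat 1)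
    (hdisc.mono fun δ h =>
      ⟨h.1, h.2.1, h.2.2.1, h.2.2.2.1, h.2.2.2.2.1, h.2.2.2.2.2.1, h.2.2.2.2.2.2 1⟩)
    hK ha hb hΦ hΦb hL hexp hLb hψ hψK hψD

/-- **THE ROOT-FREE FORM IS FALSE** (the corridor witness of item 5420, replayed on the landed
engine): on the upper half unit disc a width-one boundary corridor with a moat relocates the
conformally effective root from `3/4` to `1/2` while every root-free hypothesis holds; the two
normalised averages coincide for small meshes (`ratio_eq`), so `c ≠ 0` and the test-function lemma
force `exp((5/8)(L_{1/2} − L_{1/2} 0)) = exp((5/8)(L_{3/4} − L_{3/4} 0))` on the half-disc, which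
`endgame` refutes. [folklore] -/
theorem not_rootFree : ¬ HexObservableLimitRootFree := by
  rintro ⟨c, hc, H⟩
  have hp : (0 : ℝ) < 3 / 4 ∧ (3 / 4 : ℝ) < 1 := by norm_num
  have hq : (0 : ℝ) < 1 / 2 ∧ (1 / 2 : ℝ) < 1 := by norm_num
  have hx : hexCriticalFugacity ≠ 0 := hexCriticalFugacity_pos_lt_one.1.ne'
  -- Step 1: for every test function the two predicted limits coincide
  have key : ∀ ψ : ℂ → ℂ, Continuous ψ → HasCompactSupport ψ → tsupport ψ ⊆ HD →
      c * ∫ z, ψ z * Complex.exp ((5 / 8 : ℂ) * (Lfun (1 / 2) z - Lfun (1 / 2) 0)) =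
        c * ∫ z, ψ z * Complex.exp ((5 / 8 : ℂ) * (Lfun (3 / 4) z - Lfun (3 / 4) 0)) := by
    intro ψ hψc hψK hψD
    have h1 := instance_limit H hq false (fun δ hδ => abs_Xc δ hδ) hψc hψK hψD
    have h2 := instance_limit H hp true (fun δ hδ => abs_Tc δ hδ) hψc hψK hψD
    simp only [rootCell, Bool.false_eq_true, ↓reduceIte] at h1
    simp only [rootCell, ↓reduceIte] at h2
    obtain ⟨ε, hε, -, hthick⟩ := exists_thick_of_isCompact hψK hψD
    have heq : (fun δ : ℝ => (δ : ℂ) ^ 2 * (∑ᶠ e ∈ hexDomainMidEdges (Lam δ true),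
        ψ ((δ : ℂ) * hexMidpoint e) * hexParafermionicObservable (Lam δ true) (aEdge (Tc δ))
          hexCriticalFugacity (5 / 8) e) /
        hexParafermionicObservable (Lam δ true) (aEdge (Tc δ)) hexCriticalFugacity (5 / 8) bEdge)
        =ᶠ[𝓝[>] 0]
        fun δ : ℝ => (δ : ℂ) ^ 2 * (∑ᶠ e ∈ hexDomainMidEdges (Lam δ false),
        ψ ((δ : ℂ) * hexMidpoint e) * hexParafermionicObservable (Lam δ false) (aEdge (Xc δ))
          hexCriticalFugacity (5 / 8) e) /
        hexParafermionicObservable (Lam δ false) (aEdge (Xc δ)) hexCriticalFugacity (5 / 8) bEdge := by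
      filter_upwards [eventually_small (by positivity : 0 < ε / 2)] with δ hδ
      obtain ⟨hδ, hδ', hδε⟩ := hδ
      refine ratio_eq hδ hδ' _ _ hx ψ fun e he => ?_
      have hmem : (δ : ℂ) * hexMidpoint e ∈ tsupport ψ := subset_tsupport _ he
      have him := (hthick _ hmem).2
      rw [Complex.im_ofReal_mul] at him
      by_contra hlt
      push Not at hlt
      nlinarith
    exact tendsto_nhds_unique h1 (h2.congr' heq)
  -- Step 2: the difference of the two densities is orthogonal to all test functions, hence zero
  have hG : ∀ z ∈ HD, Complex.exp ((5 / 8 : ℂ) * (Lfun (1 / 2) z - Lfun (1 / 2) 0)) =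
      Complex.exp ((5 / 8 : ℂ) * (Lfun (3 / 4) z - Lfun (3 / 4) 0)) := by
    intro z hz
    have := eq_zero_of_forall_integral isOpen_HD
      (G := fun z => Complex.exp ((5 / 8 : ℂ) * (Lfun (1 / 2) z - Lfun (1 / 2) 0)) -
        Complex.exp ((5 / 8 : ℂ) * (Lfun (3 / 4) z - Lfun (3 / 4) 0)))
      ((continuousOn_g hq).sub (continuousOn_g hp)) (fun ψ hψc hψK hψD => ?_) hz
    · exact sub_eq_zero.1 this
    · have i1 : MeasureTheory.Integrable fun z => ψ z *
          Complex.exp ((5 / 8 : ℂ) * (Lfun (1 / 2) z - Lfun (1 / 2) 0)) :=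
        (continuous_mul_of_tsupport_subset isOpen_HD hψc hψD
          (continuousOn_g hq)).integrable_of_hasCompactSupport hψK.mul_right
      have i2 : MeasureTheory.Integrable fun z => ψ z *
          Complex.exp ((5 / 8 : ℂ) * (Lfun (3 / 4) z - Lfun (3 / 4) 0)) :=
        (continuous_mul_of_tsupport_subset isOpen_HD hψc hψD
          (continuousOn_g hp)).integrable_of_hasCompactSupport hψK.mul_right
      show ∫ z, ψ z * (Complex.exp ((5 / 8 : ℂ) * (Lfun (1 / 2) z - Lfun (1 / 2) 0)) -
          Complex.exp ((5 / 8 : ℂ) * (Lfun (3 / 4) z - Lfun (3 / 4) 0))) = 0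
      have e : (fun z => ψ z * (Complex.exp ((5 / 8 : ℂ) * (Lfun (1 / 2) z - Lfun (1 / 2) 0)) -
          Complex.exp ((5 / 8 : ℂ) * (Lfun (3 / 4) z - Lfun (3 / 4) 0)))) =
          fun z => ψ z * Complex.exp ((5 / 8 : ℂ) * (Lfun (1 / 2) z - Lfun (1 / 2) 0)) -
            ψ z * Complex.exp ((5 / 8 : ℂ) * (Lfun (3 / 4) z - Lfun (3 / 4) 0)) := by
        funext z; ring
      rw [e, MeasureTheory.integral_sub i1 i2, sub_eq_zero]
      exact mul_left_cancel₀ hc (key ψ hψc hψK hψD)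
  -- Step 3: the two normalisations are incompatible
  exact endgame hp hq (by norm_num) hG

/-- Hence the crux `ObservableToSLER` with its hypothesis STRENGTHENED back to the root-free form is
vacuously true: nothing is learned from that strengthening, and the rough-root bootstrap inside the
crux must keep lattice control at the root. [folklore] -/
theorem observableToSLER_withRootFreeHyp :
    HexObservableLimitRootFree → SAWDefectDecoherence.HexTight → SAWDefectDecoherence.HexConjecture :=
  fun h => absurd h not_rootFree

/-- Summary for the negatives index: `HexObservableLimitR` is implied by a refuted statement that
differs from it only in the two root clauses. [folklore] -/
theorem rootFree_strictly_stronger :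
    (HexObservableLimitRootFree → SAWDefectDecoherence.HexObservableLimitR) ∧
      ¬ HexObservableLimitRootFree :=
  ⟨obsLimitR_of_rootFree, not_rootFree⟩

end Summit.CriticalPhenomena.SAWScalingLimit.Theorems.ObservableToSLER.Negative
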